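import Summits.CriticalPhenomena.PercolationContinuityZ3.Theorems.PercNearOneGluingNoHeavyLowerTailIncStarCutVertex
import Summits.CriticalPhenomena.PercolationContinuityZ3.Theorems.PercNearOneGluingNoHeavyLowerTailIncStarTargetTargetCells
import Summits.CriticalPhenomena.PercolationContinuityZ3.Theorems.PercNearOneGluingNoHeavyLowerTailIncStarRootEdgeInduction
import HarnessLib

/-!
# Connectivity across an environment bridge, and the moment-form chord inequality (Theorem B, part I)

Support file for the Sahi programme (`--supports stmt-CriticalPhenomena-4575`, prover prim-sahi-p2 gen 19).  No definitions, no named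
facts, no sorries; standard axioms.  Memo `run/shared/lean/prim/prim-sahi/prim-sahi-p2/gen18/THEOREM-B-C.md` (Theorem B), `PROOF-E3.md` §28m.
Part II (`…IncStarBridgeChord`) assembles THEOREM B — the increasing star `E₃({s↔a},{s↔b},{s↔c})` lies above its chords along every
environment bridge separating one target from the other two, on every finite graph — from the two ingredients of this file:

* **One configuration at a time** (`bridge_conn_ll/_lr/_rr/_rl`, `bridge_lift_near/_far`).  `L ∌ s` is the near side; if no pair from `L` to
  `(L ∪ {s})ᶜ` is open in `ω`, the blocks `insert s L` and `Lᶜ` meet only in the cut vertex `s`, so the cut-vertex dictionary of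
  `…IncStarCutVertex` applies: near–near connections stay in the near block, near–far connections pass through the root, etc.; and after
  INSERTING the bridge `e = s(u,v)` (`u ∈ L`, `v ∉ L`; tree `IncStar.insert_pair_mem_openConn_iff`) the root-connection events become
  `{s↔a} = T ∪ (P′ ∩ F)` for a near target `a` and `{s↔b} = B⁰ ∪ (S ∩ R_b)` for a far target `b`, with `T = {s↔a in L∪{s}}`,
  `F = {u↔a in L∪{s}}`, `S = {s↔u in L∪{s}}`, `P′ = {s↔v in Lᶜ}`, `B⁰ = {s↔b in Lᶜ}`, `R_b = {v↔b in Lᶜ}` (PROOF-E3 §28m step (2)).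
* **The chord inequality in moment form** (`bridgeChord_poly`, pure real arithmetic): with product-form slopes and the four classical
  inequalities (H1)–(H4), `(1−p)E₃(0) + pE₃(1) ≤ E₃(p)`; the bracket `W ≥ 0` is `IncStar.bridgeConcavity_core` (`…IncStarBridgeConcavityCore`,
  gen 18), copied here privately because that module's olean was not yet available on the farm when this file was written.
-/

noncomputable section

namespace Summit.CriticalPhenomena.PercolationContinuityZ3.Theorems

namespace IncStar

open MeasureTheory Set Literature.Probability.Percolation Literature.Probability.LatticeModels EdgeInduction
open Literature.Probability.Percolation.BlockExploration (mem_openConn_iff_openConnIn_univ)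
open scoped Classical

variable {n : ℕ}

/-! ### The algebraic core (verbatim from `IncStar.bridgeConcavity_core`, file `…IncStarBridgeConcavityCore`, whose olean is not yet
available on the farm at the time of writing; private copies, to be replaced by the import once built) -/

/-- Copy of `IncStar.bridgeConcavity_bracket`: `0 ≤ ασ′(1 − 3σ) + γ` from `σ(α+γ) ≤ γ`, `0 ≤ σ′ ≤ 1`. [this work] -/
private theorem bcc_bracket (α γ σ σ' : ℝ) (hα : 0 ≤ α) (hγ : 0 ≤ γ) (hσ'0 : 0 ≤ σ') (hσ'1 : σ' ≤ 1)
    (H4 : σ * (α + γ) ≤ γ) : 0 ≤ α * σ' * (1 - 3 * σ) + γ := by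
  by_cases h3 : 3 * σ ≤ 1
  · have h13 : 0 ≤ 1 - 3 * σ := by linarith
    have : 0 ≤ α * σ' * (1 - 3 * σ) := mul_nonneg (mul_nonneg hα hσ'0) h13
    linarith
  · push Not at h3
    have hstep : α * (1 - 3 * σ) ≤ α * σ' * (1 - 3 * σ) := by
      have h1 : α * σ' * (1 - 3 * σ) - α * (1 - 3 * σ) = α * (1 - σ') * (3 * σ - 1) := by ring
      have h2 : 0 ≤ α * (1 - σ') * (3 * σ - 1) :=
        mul_nonneg (mul_nonneg hα (by linarith)) (by linarith)
      linarith
    have hkey : 0 ≤ α * (1 - 3 * σ) + γ := by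
      by_cases hΩ : α + γ = 0
      · have hα0 : α = 0 := by linarith
        have hγ0 : γ = 0 := by linarith
        rw [hα0, hγ0]; simp
      · have hΩpos : 0 < α + γ := lt_of_le_of_ne (by linarith) (Ne.symm hΩ)
        have hprod : 0 ≤ (α + γ) * (α * (1 - 3 * σ) + γ) := by
          have h1 : (α + γ) * (α * (1 - 3 * σ) + γ) = (α + γ) ^ 2 - 3 * α * (σ * (α + γ)) := by ring
          have h2 : 3 * α * (σ * (α + γ)) ≤ 3 * α * γ := by
            have := mul_le_mul_of_nonneg_left H4 (by linarith : (0 : ℝ) ≤ 3 * α)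
            linarith
          have h3' : 0 ≤ α ^ 2 - α * γ + γ ^ 2 := by nlinarith [sq_nonneg (α - γ), mul_nonneg hα hγ]
          nlinarith [h1, h2, h3']
        by_contra hneg
        push Not at hneg
        have : (α + γ) * (α * (1 - 3 * σ) + γ) < 0 := mul_neg_of_pos_of_neg hΩpos hneg
        linarith
    linarith

/-- Copy of `IncStar.bridgeConcavity_core`: `0 ≤ W` from (H1)–(H4) and the sign conditions. [this work] -/
private theorem bcc_core (α γ σ τ K σ' db dc dbc ξb ξc yb yc mb mc : ℝ)
    (hα : 0 ≤ α) (hγ : 0 ≤ γ) (hσ'0 : 0 ≤ σ') (hσ'1 : σ' ≤ 1) (hK : 0 ≤ K)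
    (hdb : 0 ≤ db) (hdc : 0 ≤ dc) (hξb : 0 ≤ ξb) (hξc : 0 ≤ ξc)
    (H1b : σ' * mb ≤ yb) (H1c : σ' * mc ≤ yc) (H2 : τ * σ ≤ γ + K) (H3 : db * dc ≤ dbc) (H4 : σ * (α + γ) ≤ γ) :
    0 ≤ α * σ' * (ξb + ξc + dbc) - α * σ' * (mb * dc + mc * db) + 2 * (γ + K) * db * dc
        - τ * σ * db * dc - 3 * α * σ' * σ * db * dc + α * (db * yc + dc * yb) := by
  have h1 : α * σ' * (mb * dc + mc * db) ≤ α * (db * yc + dc * yb) := by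
    have hb : α * dc * (σ' * mb) ≤ α * dc * yb := mul_le_mul_of_nonneg_left H1b (mul_nonneg hα hdc)
    have hc : α * db * (σ' * mc) ≤ α * db * yc := mul_le_mul_of_nonneg_left H1c (mul_nonneg hα hdb)
    nlinarith [hb, hc]
  have h2 : γ * (db * dc) ≤ 2 * (γ + K) * db * dc - τ * σ * db * dc := by
    have hdd : 0 ≤ db * dc := mul_nonneg hdb hdc
    have : 0 ≤ (γ + K - τ * σ) * (db * dc) := mul_nonneg (by linarith) hdd
    have : 0 ≤ K * (db * dc) := mul_nonneg hK hdd
    nlinarith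
  have h3 : α * σ' * (db * dc) ≤ α * σ' * dbc := mul_le_mul_of_nonneg_left H3 (mul_nonneg hα hσ'0)
  have hξ : 0 ≤ α * σ' * (ξb + ξc) := mul_nonneg (mul_nonneg hα hσ'0) (by linarith)
  have hbr : 0 ≤ α * σ' * (1 - 3 * σ) + γ := bcc_bracket α γ σ σ' hα hγ hσ'0 hσ'1 H4
  have hmain : 0 ≤ (db * dc) * (α * σ' * (1 - 3 * σ) + γ) := mul_nonneg (mul_nonneg hdb hdc) hbr
  have hid : (db * dc) * (α * σ' * (1 - 3 * σ) + γ)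
      = α * σ' * (db * dc) + γ * (db * dc) - 3 * α * σ' * σ * db * dc := by ring
  nlinarith [h1, h2, h3, hξ, hmain, hid]

/-! ### Pure real arithmetic: the chord inequality in moment form -/

/-- **The chord inequality in moment form.**  With the `t = 0` moments `τ, m_b, m_c, m_bc` (and `m_ab = τm_b`, `m_ac = τm_c`, `m_abc = τm_bc`),
the `t = 1` triple moment `m1` and the product-form slopes `δ_a = ασ′`, `δ_b = σd_b`, `δ_c = σd_c`, `δ_ab = γK·d_b + αy_b`, `δ_ac = γK·d_c + αy_c`,
`δ_bc = σ(ξ_b+ξ_c+d_bc)` (`γK = γ + K ≥ γ`), the four classical inequalities (H1)–(H4) give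
`(1−p)E₃(0) + pE₃(1) ≤ E₃(p)` for `p ∈ [0,1]`.  Identity: `E₃(p) − [(1−p)E₃(0) + pE₃(1)] = p(1−p)(σW + δ_aδ_bδ_c(2−p))`, `W ≥ 0` by
`bridgeConcavity_core`. [this work] -/
theorem bridgeChord_poly (p τ mb mc mbc m1 α γ σ gK σ' db dc dbc ξb ξc yb yc : ℝ)
    (hp0 : 0 ≤ p) (hp1 : p ≤ 1)
    (hα : 0 ≤ α) (hγ : 0 ≤ γ) (hσ : 0 ≤ σ) (hσ'0 : 0 ≤ σ') (hσ'1 : σ' ≤ 1) (hK : γ ≤ gK)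
    (hdb : 0 ≤ db) (hdc : 0 ≤ dc) (hξb : 0 ≤ ξb) (hξc : 0 ≤ ξc)
    (H1b : σ' * mb ≤ yb) (H1c : σ' * mc ≤ yc) (H2 : τ * σ ≤ gK) (H3 : db * dc ≤ dbc) (H4 : σ * (α + γ) ≤ γ) :
    (1 - p) * (τ * (mbc - mb * mc))
      + p * (2 * m1 + (τ + α * σ') * (mb + σ * db) * (mc + σ * dc)
          - ((τ + α * σ') * (mbc + σ * (ξb + ξc + dbc)) + (mb + σ * db) * (τ * mc + (gK * dc + α * yc))
              + (mc + σ * dc) * (τ * mb + (gK * db + α * yb))))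
    ≤ 2 * (τ * mbc + p * (m1 - τ * mbc))
        + (τ + p * (α * σ')) * (mb + p * (σ * db)) * (mc + p * (σ * dc))
        - ((τ + p * (α * σ')) * (mbc + p * (σ * (ξb + ξc + dbc)))
            + (mb + p * (σ * db)) * (τ * mc + p * (gK * dc + α * yc))
            + (mc + p * (σ * dc)) * (τ * mb + p * (gK * db + α * yb))) := by
  have hW := bcc_core α γ σ τ (gK - γ) σ' db dc dbc ξb ξc yb yc mb mc hα hγ hσ'0 hσ'1 (by linarith)
    hdb hdc hξb hξc H1b H1c (by linarith) H3 H4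
  rw [← sub_nonneg]
  have key : 2 * (τ * mbc + p * (m1 - τ * mbc))
        + (τ + p * (α * σ')) * (mb + p * (σ * db)) * (mc + p * (σ * dc))
        - ((τ + p * (α * σ')) * (mbc + p * (σ * (ξb + ξc + dbc)))
            + (mb + p * (σ * db)) * (τ * mc + p * (gK * dc + α * yc))
            + (mc + p * (σ * dc)) * (τ * mb + p * (gK * db + α * yb)))
      - ((1 - p) * (τ * (mbc - mb * mc))
        + p * (2 * m1 + (τ + α * σ') * (mb + σ * db) * (mc + σ * dc)
          - ((τ + α * σ') * (mbc + σ * (ξb + ξc + dbc)) + (mb + σ * db) * (τ * mc + (gK * dc + α * yc))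
              + (mc + σ * dc) * (τ * mb + (gK * db + α * yb)))))
      = p * (1 - p) * (σ * (α * σ' * (ξb + ξc + dbc) - α * σ' * (mb * dc + mc * db) + 2 * (γ + (gK - γ)) * db * dc
        - τ * σ * db * dc - 3 * α * σ' * σ * db * dc + α * (db * yc + dc * yb))
          + (α * σ') * (db * σ) * (dc * σ) * (2 - p)) := by
    ring
  rw [key]
  have h1 : 0 ≤ p * (1 - p) := mul_nonneg hp0 (by linarith)
  have h2 : 0 ≤ (α * σ') * (db * σ) * (dc * σ) * (2 - p) :=
    mul_nonneg (mul_nonneg (mul_nonneg (mul_nonneg hα hσ'0) (mul_nonneg hdb hσ)) (mul_nonneg hdc hσ)) (by linarith)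
  exact mul_nonneg h1 (add_nonneg (mul_nonneg hσ hW) h2)

/-! ### Plumbing -/

/-- Almost-sure congruence: events that agree on a probability-one set have the same probability. [folklore] -/
theorem real_congr_of_sure {μ : Measure (BondConfig (Fin n))} [IsProbabilityMeasure μ] {G A A' : Set (BondConfig (Fin n))}
    (hG : μ.real G = 1) (h : ∀ ω ∈ G, (ω ∈ A ↔ ω ∈ A')) : μ.real A = μ.real A' := by
  rw [real_eq_real_inter_of_real_eq_one MeasurableSet.of_discrete hG A,
    real_eq_real_inter_of_real_eq_one MeasurableSet.of_discrete hG A']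
  congr 1
  ext ω
  simp only [Set.mem_inter_iff]
  constructor
  · rintro ⟨h1, h2⟩; exact ⟨(h ω h2).1 h1, h2⟩
  · rintro ⟨h1, h2⟩; exact ⟨(h ω h2).2 h1, h2⟩

/-! ### Connectivity across an environment bridge, one configuration at a time

Throughout, `L` is the near side, `s ∉ L` the root; the hypothesis `hω` says that no pair from `L` to `(L ∪ {s})ᶜ` is open in `ω`.  The two
blocks `insert s L` and `Lᶜ` meet exactly in the cut vertex `s`, so the cut-vertex dictionary of `…IncStarCutVertex` applies. -/

/-- The two blocks meet only in the root. [folklore] -/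
theorem bridge_cv_hV (L : Set (Fin n)) (s : Fin n) : ∀ x : Fin n, x ∈ insert s L → x ∈ Lᶜ → x = s := by
  intro x hx hx'
  rcases Set.mem_insert_iff.1 hx with h | h
  · exact h
  · exact absurd h hx'

/-- The two blocks meet only in the root (blocks swapped). [folklore] -/
theorem bridge_cv_hV' (L : Set (Fin n)) (s : Fin n) : ∀ x : Fin n, x ∈ Lᶜ → x ∈ insert s L → x = s :=
  fun x h1 h2 => bridge_cv_hV L s x h2 h1

/-- The two blocks cover everything. [folklore] -/
theorem bridge_cv_univ (L : Set (Fin n)) (s : Fin n) : insert s L ∪ Lᶜ = Set.univ := by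
  ext x
  simp only [Set.mem_union, Set.mem_insert_iff, Set.mem_compl_iff, Set.mem_univ, iff_true]
  tauto

/-- Cut-vertex separation hypothesis from the bridge hypothesis. [folklore] -/
theorem bridge_cv_sep (L : Set (Fin n)) {s : Fin n} {ω : BondConfig (Fin n)}
    (hω : ∀ x y : Fin n, x ∈ L → y ∉ L → y ≠ s → s(x, y) ∉ ω) :
    ∀ x y : Fin n, x ∈ insert s L → y ∈ Lᶜ → x ≠ s → y ≠ s → s(x, y) ∉ ω := by
  intro x y hx hy hxs hys
  rcases Set.mem_insert_iff.1 hx with h | h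
  · exact absurd h hxs
  · exact hω x y h hy hys

/-- Cut-vertex separation hypothesis from the bridge hypothesis (blocks swapped). [folklore] -/
theorem bridge_cv_sep' (L : Set (Fin n)) {s : Fin n} {ω : BondConfig (Fin n)}
    (hω : ∀ x y : Fin n, x ∈ L → y ∉ L → y ≠ s → s(x, y) ∉ ω) :
    ∀ x y : Fin n, x ∈ Lᶜ → y ∈ insert s L → x ≠ s → y ≠ s → s(x, y) ∉ ω := by
  intro x y hx hy hxs hys
  rw [Sym2.eq_swap]
  exact bridge_cv_sep L hω y x hy hx hys hxs

/-- **Near–near connections stay in the near block.** [this work] -/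
theorem bridge_conn_ll (L : Set (Fin n)) {s : Fin n} (hsL : s ∉ L) {ω : BondConfig (Fin n)}
    (hω : ∀ x y : Fin n, x ∈ L → y ∉ L → y ≠ s → s(x, y) ∉ ω) {x t : Fin n}
    (hx : x ∈ insert s L) (ht : t ∈ insert s L) :
    ω ∈ openConn x t ↔ ω ∈ openConnIn (insert s L) x t := by
  have h := IncStarCutVertex.openConnIn_union_iff_of_mem_left (bridge_cv_hV L s) (Set.mem_insert s L)
    (show s ∈ Lᶜ from hsL) (bridge_cv_sep L hω) hx ht
  rw [bridge_cv_univ L s] at h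
  rw [mem_openConn_iff_openConnIn_univ]
  exact h

/-- **Near–far connections pass through the root.** [this work] -/
theorem bridge_conn_lr (L : Set (Fin n)) {s : Fin n} (hsL : s ∉ L) {ω : BondConfig (Fin n)}
    (hω : ∀ x y : Fin n, x ∈ L → y ∉ L → y ≠ s → s(x, y) ∉ ω) {x t : Fin n}
    (hx : x ∈ insert s L) (ht : t ∈ Lᶜ) :
    ω ∈ openConn x t ↔ ω ∈ openConnIn (insert s L) x s ∧ ω ∈ openConnIn Lᶜ s t := by
  have h := IncStarCutVertex.openConnIn_union_iff_of_mem_right (bridge_cv_hV L s) (Set.mem_insert s L)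
    (show s ∈ Lᶜ from hsL) (bridge_cv_sep L hω) hx ht
  rw [bridge_cv_univ L s] at h
  rw [mem_openConn_iff_openConnIn_univ]
  exact h

/-- **Far–far connections stay in the far block.** [this work] -/
theorem bridge_conn_rr (L : Set (Fin n)) {s : Fin n} (hsL : s ∉ L) {ω : BondConfig (Fin n)}
    (hω : ∀ x y : Fin n, x ∈ L → y ∉ L → y ≠ s → s(x, y) ∉ ω) {x t : Fin n}
    (hx : x ∈ Lᶜ) (ht : t ∈ Lᶜ) :
    ω ∈ openConn x t ↔ ω ∈ openConnIn Lᶜ x t := by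
  have h := IncStarCutVertex.openConnIn_union_iff_of_mem_left (V₁ := Lᶜ) (V₂ := insert s L) (bridge_cv_hV' L s)
    (show s ∈ Lᶜ from hsL) (Set.mem_insert s L) (bridge_cv_sep' L hω) hx ht
  rw [Set.union_comm, bridge_cv_univ L s] at h
  rw [mem_openConn_iff_openConnIn_univ]
  exact h

/-- **Far–near connections pass through the root.** [this work] -/
theorem bridge_conn_rl (L : Set (Fin n)) {s : Fin n} (hsL : s ∉ L) {ω : BondConfig (Fin n)}
    (hω : ∀ x y : Fin n, x ∈ L → y ∉ L → y ≠ s → s(x, y) ∉ ω) {x t : Fin n}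
    (hx : x ∈ Lᶜ) (ht : t ∈ insert s L) :
    ω ∈ openConn x t ↔ ω ∈ openConnIn Lᶜ x s ∧ ω ∈ openConnIn (insert s L) s t := by
  have h := IncStarCutVertex.openConnIn_union_iff_of_mem_right (V₁ := Lᶜ) (V₂ := insert s L) (bridge_cv_hV' L s)
    (show s ∈ Lᶜ from hsL) (Set.mem_insert s L) (bridge_cv_sep' L hω) hx ht
  rw [Set.union_comm, bridge_cv_univ L s] at h
  rw [mem_openConn_iff_openConnIn_univ]
  exact h

/-- **Opening the bridge, near target**: `{s↔a}` after inserting `e = s(u,v)` is `T ∪ (P′ ∩ F)` —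
`a` hit inside the near block, or `v` hit inside the far block and `a ~ u` inside the near block. [this work] -/
theorem bridge_lift_near (L : Set (Fin n)) {s u v a : Fin n} (hsL : s ∉ L) (huL : u ∈ L) (hvL : v ∉ L) (haL : a ∈ L)
    {ω : BondConfig (Fin n)} (hω : ∀ x y : Fin n, x ∈ L → y ∉ L → y ≠ s → s(x, y) ∉ ω) :
    insert s(u, v) ω ∈ openConn s a ↔
      ω ∈ openConnIn (insert s L) s a ∨ (ω ∈ openConnIn Lᶜ s v ∧ ω ∈ openConnIn (insert s L) u a) := by
  have hs1 : s ∈ insert s L := Set.mem_insert s L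
  have hu1 : u ∈ insert s L := Set.mem_insert_of_mem s huL
  have ha1 : a ∈ insert s L := Set.mem_insert_of_mem s haL
  have hs2 : s ∈ Lᶜ := hsL
  have hv2 : v ∈ Lᶜ := hvL
  rw [insert_pair_mem_openConn_iff, bridge_conn_ll L hsL hω hs1 ha1, bridge_conn_ll L hsL hω hs1 hu1,
    bridge_conn_rr L hsL hω hs2 hv2, bridge_conn_ll L hsL hω hu1 ha1, bridge_conn_rl L hsL hω hv2 ha1]
  constructor
  · rintro (hT | ⟨hSP, hF⟩)
    · exact Or.inl hT
    · rcases hF with hF | ⟨_, hT⟩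
      · rcases hSP with hS | hP
        · exact Or.inl (PlanarDuality.openConnIn_trans hS hF)
        · exact Or.inr ⟨hP, hF⟩
      · exact Or.inl hT
  · rintro (hT | ⟨hP, hF⟩)
    · exact Or.inl hT
    · exact Or.inr ⟨Or.inr hP, Or.inl hF⟩

/-- **Opening the bridge, far target**: `{s↔b}` after inserting `e = s(u,v)` is `B⁰ ∪ (S ∩ R_b)` —
`b` hit inside the far block, or `u` hit inside the near block and `v ~ b` inside the far block. [this work] -/
theorem bridge_lift_far (L : Set (Fin n)) {s u v b : Fin n} (hsL : s ∉ L) (huL : u ∈ L) (hvL : v ∉ L) (hbL : b ∉ L)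
    {ω : BondConfig (Fin n)} (hω : ∀ x y : Fin n, x ∈ L → y ∉ L → y ≠ s → s(x, y) ∉ ω) :
    insert s(u, v) ω ∈ openConn s b ↔
      ω ∈ openConnIn Lᶜ s b ∨ (ω ∈ openConnIn (insert s L) s u ∧ ω ∈ openConnIn Lᶜ v b) := by
  have hs1 : s ∈ insert s L := Set.mem_insert s L
  have hu1 : u ∈ insert s L := Set.mem_insert_of_mem s huL
  have hs2 : s ∈ Lᶜ := hsL
  have hv2 : v ∈ Lᶜ := hvL
  have hb2 : b ∈ Lᶜ := hbL
  rw [insert_pair_mem_openConn_iff, bridge_conn_lr L hsL hω hs1 hb2, bridge_conn_ll L hsL hω hs1 hu1,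
    bridge_conn_rr L hsL hω hs2 hv2, bridge_conn_lr L hsL hω hu1 hb2, bridge_conn_rr L hsL hω hv2 hb2]
  constructor
  · rintro (⟨-, hB⟩ | ⟨hSP, hX⟩)
    · exact Or.inl hB
    · rcases hX with ⟨-, hB⟩ | hR
      · exact Or.inl hB
      · rcases hSP with hS | hP
        · exact Or.inr ⟨hS, hR⟩
        · exact Or.inl (PlanarDuality.openConnIn_trans hP hR)
  · rintro (hB | ⟨hS, hR⟩)
    · exact Or.inl ⟨⟨hs1, hs1, SimpleGraph.Reachable.refl _⟩, hB⟩
    · exact Or.inr ⟨Or.inl hS, Or.inr hR⟩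

end IncStar

end Summit.CriticalPhenomena.PercolationContinuityZ3.Theorems
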